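import Summits.QuantumFields.BalabanUV.Beta.GAN24.DerivativeRateTransferJensenMassFreeEnd

/-!
# `BalabanUV.Beta.GAN24.DerivativeRateTransferJensenMassFreeSpread` — binder row G-an2-4 ∕ (CONV-C), route R6 «VALUES, NOT DERIVATIVES», PART 57:
# THE POLAR PAIR's HOLONOMY LETTER IS A LATTICE-LOOP LETTER — for the polar coarse link the pointwise root-frame defect `κ` of PARTs 47–56 (a loop
# through the coarse link `R′`, which is NOT a lattice path) is at most TWICE the pairwise SPREAD `D` of the open root-to-root transports, and that spread
# is the holonomy defect of CLOSED LATTICE loops (tree′ · chain · tree · tree · chain · tree′): `|(1 − V_x)w|² ≤ (2D)²|w|²`; so PART 53's `δ = 0` END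
# holds with `κ := 2D` (unit b2b-balaban-gan24-p3, gen 43; v1)

NOT IN PRINT; OUR PROOF (for the ROUTE; [folklore] finite-dimensional linear algebra over `ℝ` — Jensen for convex combinations (PART 21), the identity
`(1 + P)(1 − P) = 1 − P²`, and «`P` positive semidefinite ⟹ `|w| ≤ |(1 + P)w|`»; PART 53's END BY NAME).  HONEST FRAMING (cell contract, verbatim):
«discharging `BetaPertH` makes Bałaban's UV stability UNCONDITIONAL — a real constructive-QFT result; it is NOT the continuum limit and NOT the Clay
problem.»  HONEST DEPENDENCY (verbatim): «continuum YM on T⁴ ⇐ BetaPertH ∧ nine spine estimates (0/9 proved); BetaPertH ⇐ (D1) ∧ (D4) ∧ CAP+tail;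
G-an2-4 gates asym, D1 and NE2/3/4.»

WHY THIS FILE.  The pricing desk's display for (STAB)^{cov} reads «NEEDS-CONSTANT (p̂ only) modulo … (C) κ ≤ 3A_{d,L}·p̂ (paper)» (PRICING-GAN24 v3.49 ∕
v3.50): the one letter of PARTs 52–56 that is not bookkeeping is the pointwise defect `κ` of the root-frame loop transports `V_x = W(y,x)T_xW(y′,σx)ᵀR′ᵀ`,
and for the POLAR link `R′` (the orthogonal polar factor of the block mean `M = Σ_x q_xτ_x` of the open transports `τ_x = W(y,x)T_xW(y′,σx)ᵀ`) that loop
is NOT a lattice loop, so lattice Stokes does not apply to it directly.  THIS FILE closes that gap abstractly: with `P := Σ_x q_xV_x = M·R′ᵀ` SYMMETRIC and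
POSITIVE SEMIDEFINITE (the polar factorisation `M = P·R′` as DEFINED — `P = (MMᵀ)^{1/2}`) and the pairwise SPREAD `|(V_x − V_{x′})w|² ≤ D²|w|²`,
(§1) `|(1 − P²)u| ≤ D|u|` (`1 − P² = Σ_{x,x′} q_xq_{x′}(V_{x′} − V_x)V_{x′}ᵀ`, Jensen twice), (§2) `|(1 − P)u| ≤ |(1 + P)(1 − P)u| = |(1 − P²)u|` (`P ≥ 0`), hence
(§3) **`rootDefect_le_two_spread`**: `|(1 − V_x)u|² ≤ (2D)²|u|²` (`1 − V_x = (P − V_x) + (1 − P)`, each piece `≤ D`).  Since `R′` CANCELS in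
`V_x − V_{x′} = (τ_x − τ_{x′})R′ᵀ` and `|(τ_x − τ_{x′})v| = |(τ_{x′}ᵀτ_x − 1)v|`, the spread `D` is the holonomy defect of the CLOSED LATTICE loops
`h_{xx′} := τ_{x′}ᵀτ_x` = root′ → σx′ (tree′) → x′ (chain back) → root (tree) → x (tree) → σx (chain) → root′ (tree′) (§3 `spread_eq_loopDefect`), to which
lattice Stokes applies (length `≤ 4·depth + 2ℓ`; the plaquette count is LENS ITEM 12 (C)'s, not typed here).  (§4) **`rootDefect_le_of_polar_loops`**: in
PART 47's letters, `hsym` + `hPpsd` + the loop letter `hloop : |(h_{xx′} − 1)w|² ≤ D²|w|²` ⟹ PART 47 ∕ 53's hypothesis `hN` with `κ = 2D`, and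
**`covJensen_polar_massFree_of_loops`** = PART 53's END with `κ := 2D` (`D < 1`).

WHAT THIS FILE PROVES (0 sorry, 0 `def`, nothing cited): §1 `dotProduct_self_wsum_le_of_sq_le`, `one_sub_sq_mulVec_eq`, `sq_one_sub_sq_le_spread`; §2
`dotProduct_self_le_one_add_psd`, `sq_one_sub_le_sq_one_sub_sq`; §3 **`rootDefect_le_two_spread`**, `spread_eq_loopDefect`; §4 **`rootDefect_le_of_polar_loops`**,
**`covJensen_polar_massFree_of_loops`**.
WHAT IT DOES NOT DO: bound the lattice-loop defect `D` by the plaquette letter `p̂` (lattice Stokes on PART 24's encoding — LENS ITEM 12 (C), paper),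
prove that the polar factor exists, instantiate anything of Bałaban's, or claim (CONS) ∕ exact (STAB).  SUPPLIER work on route R6 (rank 2, REDUCTION, no
seat); no consumer of record; NEVER «G-an2-4 closed»; NOT (CONV-C), NOT D1, NOT `BetaPertH`, NOT continuum, NOT Clay.  Records:
`HOME/b2b-balaban-gan24-p3/WOODBURY-FIBRE.md` v14.3. -/

noncomputable section

open Matrix Finset

namespace Summit.QuantumFields.BalabanUV.Beta.GAN24.DerivativeRateTransferJensenMassFreeSpread

open Summit.QuantumFields.BalabanUV.Beta.GAN24.DerivativeRateTransferLoewnerKKT (mulVec_dotProduct_eq)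
open Summit.QuantumFields.BalabanUV.Beta.GAN24.DerivativeRateTransferJensenChain
open Summit.QuantumFields.BalabanUV.Beta.GAN24.DerivativeRateTransferJensen
open Summit.QuantumFields.BalabanUV.Beta.GAN24.DerivativeRateTransferJensenMeanZero
open Summit.QuantumFields.BalabanUV.Beta.GAN24.DerivativeRateTransferJensenMassFreeEnd

/-! ## §1 The square of the mean transport: `|(1 − P²)u| ≤ D|u|` -/

section Spread

variable {o ν : Type*} [Fintype o] [DecidableEq o] [Fintype ν]

omit [DecidableEq o] [Fintype ν] in
/-- Jensen against a uniform pointwise bound: `q ≥ 0`, `Σq ≤ 1`, `|a_x|² ≤ B` for all `x` ⟹ `|Σ_x q_x•a_x|² ≤ B` (`0 ≤ B`). [folklore] -/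
theorem dotProduct_self_wsum_le_of_sq_le (s : Finset ν) {q : ν → ℝ} (hq : ∀ x ∈ s, 0 ≤ q x) (hq1 : ∑ x ∈ s, q x ≤ 1)
    (a : ν → o → ℝ) {B : ℝ} (hB : 0 ≤ B) (ha : ∀ x ∈ s, a x ⬝ᵥ a x ≤ B) :
    (∑ x ∈ s, q x • a x) ⬝ᵥ (∑ x ∈ s, q x • a x) ≤ B := by
  refine (dotProduct_self_wsum_le' s hq hq1 a).trans ?_
  calc ∑ x ∈ s, q x * (a x ⬝ᵥ a x) ≤ ∑ x ∈ s, q x * B := Finset.sum_le_sum fun x hx => mul_le_mul_of_nonneg_left (ha x hx) (hq x hx)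
    _ = (∑ x ∈ s, q x) * B := by rw [Finset.sum_mul]
    _ ≤ 1 * B := mul_le_mul_of_nonneg_right hq1 hB
    _ = B := one_mul B

/-- **`1 − P·Pᵀ` as a double convex combination**: `P = Σ_x q_xV_x` with `Σ_x q_x = 1` and `V_{x′}` orthogonal ⟹
`(1 − P·Pᵀ)u = Σ_x q_x•Σ_{x′} q_{x′}•(V_{x′} − V_x)(V_{x′}ᵀu)`. [folklore] -/
theorem one_sub_sq_mulVec_eq {q : ν → ℝ} (hq1 : ∑ x, q x = 1) {V : ν → Matrix o o ℝ} (hV : ∀ x, (V x)ᵀ * V x = 1) (u : o → ℝ) :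
    (1 - (∑ x, q x • V x) * (∑ x, q x • V x)ᵀ) *ᵥ u = ∑ x, q x • ∑ x', q x' • ((V x' - V x) *ᵥ ((V x')ᵀ *ᵥ u)) := by
  have hVVt : ∀ x', V x' * (V x')ᵀ = 1 := fun x' => mul_transpose_of_orthogonal (hV x')
  have hP : ∀ v : o → ℝ, (∑ x, q x • V x) *ᵥ v = ∑ x, q x • (V x *ᵥ v) := fun v => by
    rw [Matrix.sum_mulVec]; exact Finset.sum_congr rfl fun x _ => smul_mulVec _ _ _
  have hPt : ∀ v : o → ℝ, (∑ x, q x • V x)ᵀ *ᵥ v = ∑ x, q x • ((V x)ᵀ *ᵥ v) := fun v => by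
    rw [transpose_sum, Matrix.sum_mulVec]; exact Finset.sum_congr rfl fun x _ => by rw [transpose_smul, smul_mulVec]
  -- each summand of the right side: `(V x′ − V x)(V x′ᵀ u) = u − V x (V x′ᵀ u)`
  have hterm : ∀ x x', (V x' - V x) *ᵥ ((V x')ᵀ *ᵥ u) = u - V x *ᵥ ((V x')ᵀ *ᵥ u) := fun x x' => by
    rw [sub_mulVec, mulVec_mulVec, hVVt x', one_mulVec]
  have rhs : ∑ x, q x • ∑ x', q x' • ((V x' - V x) *ᵥ ((V x')ᵀ *ᵥ u)) = u - ∑ x, q x • ∑ x', q x' • (V x *ᵥ ((V x')ᵀ *ᵥ u)) := by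
    have inner : ∀ x, ∑ x', q x' • ((V x' - V x) *ᵥ ((V x')ᵀ *ᵥ u)) = u - ∑ x', q x' • (V x *ᵥ ((V x')ᵀ *ᵥ u)) := fun x => by
      rw [Finset.sum_congr rfl fun x' _ => by rw [hterm x x', smul_sub], Finset.sum_sub_distrib, ← Finset.sum_smul, hq1, one_smul]
    rw [Finset.sum_congr rfl fun x _ => by rw [inner x, smul_sub], Finset.sum_sub_distrib, ← Finset.sum_smul, hq1, one_smul]
  have lhs : (1 - (∑ x, q x • V x) * (∑ x, q x • V x)ᵀ) *ᵥ u = u - ∑ x, q x • ∑ x', q x' • (V x *ᵥ ((V x')ᵀ *ᵥ u)) := by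
    rw [sub_mulVec, one_mulVec, ← mulVec_mulVec, hPt, hP]
    congr 1
    refine Finset.sum_congr rfl fun x _ => ?_
    rw [Matrix.mulVec_sum]
    congr 1
    refine Finset.sum_congr rfl fun x' _ => ?_
    rw [mulVec_smul]
  rw [lhs, rhs]

/-- **`sq_one_sub_sq_le_spread`** — `|(1 − P·Pᵀ)u|² ≤ D²|u|²` for `P = Σ_x q_xV_x` (`q ≥ 0`, `Σq = 1`, `V_x` orthogonal) with pairwise SPREAD
`|(V_{x′} − V_x)w|² ≤ D²|w|²`. [our proof] -/
theorem sq_one_sub_sq_le_spread {q : ν → ℝ} (hq : ∀ x, 0 ≤ q x) (hq1 : ∑ x, q x = 1) {V : ν → Matrix o o ℝ} (hV : ∀ x, (V x)ᵀ * V x = 1)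
    {D : ℝ} (hD : ∀ x x' (w : o → ℝ), ((V x' - V x) *ᵥ w) ⬝ᵥ ((V x' - V x) *ᵥ w) ≤ D ^ 2 * (w ⬝ᵥ w)) (u : o → ℝ) :
    ((1 - (∑ x, q x • V x) * (∑ x, q x • V x)ᵀ) *ᵥ u) ⬝ᵥ ((1 - (∑ x, q x • V x) * (∑ x, q x • V x)ᵀ) *ᵥ u) ≤ D ^ 2 * (u ⬝ᵥ u) := by
  rw [one_sub_sq_mulVec_eq hq1 hV u]
  have hB : 0 ≤ D ^ 2 * (u ⬝ᵥ u) := mul_nonneg (sq_nonneg D) (dotProduct_self_nonneg' u)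
  refine dotProduct_self_wsum_le_of_sq_le Finset.univ (fun x _ => hq x) hq1.le _ hB fun x _ => ?_
  refine dotProduct_self_wsum_le_of_sq_le Finset.univ (fun x _ => hq x) hq1.le _ hB fun x' _ => ?_
  refine (hD x x' _).trans (le_of_eq ?_)
  rw [self_of_orthogonal (transpose_orthogonal (hV x'))]

end Spread

/-! ## §2 `P ≥ 0` ⟹ `|(1 − P)u| ≤ |(1 − P²)u|` -/

section Psd

variable {o : Type*} [Fintype o] [DecidableEq o]

omit [DecidableEq o] in
/-- `P` positive semidefinite (as a form) ⟹ `|w|² ≤ |(1 + P)w|²` (`|(1+P)w|² = |w|² + 2⟨w,Pw⟩ + |Pw|²`). [folklore] -/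
theorem dotProduct_self_le_one_add_psd {P : Matrix o o ℝ} (hpsd : ∀ w : o → ℝ, 0 ≤ w ⬝ᵥ (P *ᵥ w)) (w : o → ℝ) :
    w ⬝ᵥ w ≤ (w + P *ᵥ w) ⬝ᵥ (w + P *ᵥ w) := by
  have h1 := hpsd w
  have h2 : 0 ≤ (P *ᵥ w) ⬝ᵥ (P *ᵥ w) := dotProduct_self_nonneg' _
  rw [add_dotProduct, dotProduct_add, dotProduct_add, dotProduct_comm (P *ᵥ w) w]
  linarith

/-- **`sq_one_sub_le_sq_one_sub_sq`**: `Pᵀ = P`, `P ≥ 0` ⟹ `|(1 − P)u|² ≤ |(1 − P·Pᵀ)u|²` (`(1 + P)(1 − P)u = (1 − P²)u`). [folklore] -/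
theorem sq_one_sub_le_sq_one_sub_sq {P : Matrix o o ℝ} (hP : Pᵀ = P) (hpsd : ∀ w : o → ℝ, 0 ≤ w ⬝ᵥ (P *ᵥ w)) (u : o → ℝ) :
    ((1 - P) *ᵥ u) ⬝ᵥ ((1 - P) *ᵥ u) ≤ ((1 - P * Pᵀ) *ᵥ u) ⬝ᵥ ((1 - P * Pᵀ) *ᵥ u) := by
  have e : (1 - P) *ᵥ u + P *ᵥ ((1 - P) *ᵥ u) = (1 - P * Pᵀ) *ᵥ u := by
    rw [hP, mulVec_mulVec, ← add_mulVec]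
    congr 1
    rw [Matrix.mul_sub, Matrix.mul_one]; abel
  have h := dotProduct_self_le_one_add_psd hpsd ((1 - P) *ᵥ u)
  rwa [e] at h

end Psd

/-! ## §3 The polar pair's pointwise defect is twice the spread; the spread is a closed-loop defect -/

section Root

variable {o ν : Type*} [Fintype o] [DecidableEq o] [Fintype ν]

/-- **`rootDefect_le_two_spread` — THE POLAR PAIR's `κ` IS TWICE THE SPREAD** [our proof]: weights `q ≥ 0`, `Σq = 1`, orthogonal `V_x`, the mean
`P = Σ_x q_xV_x` SYMMETRIC and POSITIVE SEMIDEFINITE (the polar convention as defined), pairwise spread `|(V_{x′} − V_x)w|² ≤ D²|w|²` ⟹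
`|(1 − V_x)u|² ≤ (2D)²|u|²` for every `x` (`1 − V_x = (P − V_x) + (1 − P)`: the first piece is a convex combination of differences, the second is
`≤ |(1 − P²)u| ≤ D|u|` by §1–§2). -/
theorem rootDefect_le_two_spread {q : ν → ℝ} (hq : ∀ x, 0 ≤ q x) (hq1 : ∑ x, q x = 1) {V : ν → Matrix o o ℝ} (hV : ∀ x, (V x)ᵀ * V x = 1)
    (hsym : (∑ x, q x • V x)ᵀ = ∑ x, q x • V x) (hpsd : ∀ w : o → ℝ, 0 ≤ w ⬝ᵥ ((∑ x, q x • V x) *ᵥ w))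
    {D : ℝ} (hD : ∀ x x' (w : o → ℝ), ((V x' - V x) *ᵥ w) ⬝ᵥ ((V x' - V x) *ᵥ w) ≤ D ^ 2 * (w ⬝ᵥ w)) (x : ν) (u : o → ℝ) :
    ((1 - V x) *ᵥ u) ⬝ᵥ ((1 - V x) *ᵥ u) ≤ (2 * D) ^ 2 * (u ⬝ᵥ u) := by
  set P : Matrix o o ℝ := ∑ x, q x • V x with hPdef
  -- (a) `(P − V_x)u = Σ_{x′} q_{x′}(V_{x′} − V_x)u`, Jensen
  have ha : ((P - V x) *ᵥ u) ⬝ᵥ ((P - V x) *ᵥ u) ≤ D ^ 2 * (u ⬝ᵥ u) := by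
    have e : (P - V x) *ᵥ u = ∑ x', q x' • ((V x' - V x) *ᵥ u) := by
      have : P - V x = ∑ x', q x' • (V x' - V x) := by
        rw [hPdef, Finset.sum_congr rfl fun x' _ => smul_sub (q x') (V x') (V x), Finset.sum_sub_distrib, ← Finset.sum_smul, hq1, one_smul]
      rw [this, Matrix.sum_mulVec]
      exact Finset.sum_congr rfl fun x' _ => smul_mulVec _ _ _
    rw [e]
    exact dotProduct_self_wsum_le_of_sq_le Finset.univ (fun x' _ => hq x') hq1.le _ (mul_nonneg (sq_nonneg D) (dotProduct_self_nonneg' u))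
      fun x' _ => hD x x' u
  -- (b) `|(1 − P)u|² ≤ |(1 − PPᵀ)u|² ≤ D²|u|²`
  have hb : ((1 - P) *ᵥ u) ⬝ᵥ ((1 - P) *ᵥ u) ≤ D ^ 2 * (u ⬝ᵥ u) :=
    (sq_one_sub_le_sq_one_sub_sq hsym hpsd u).trans (sq_one_sub_sq_le_spread hq hq1 hV hD u)
  -- combine with `|a + b|² ≤ 2|a|² + 2|b|²`
  have e : (1 - V x) *ᵥ u = (P - V x) *ᵥ u + (1 - P) *ᵥ u := by rw [← add_mulVec]; congr 1; abel
  rw [e]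
  have h := dotProduct_self_add_le ((P - V x) *ᵥ u) ((1 - P) *ᵥ u) one_pos
  rw [inv_one] at h
  nlinarith [h, ha, hb]

omit [Fintype ν] in
/-- **`spread_eq_loopDefect`** — `R′` drops out and the spread is a CLOSED-loop defect: with `V_x = τ_x·R′ᵀ` (`τ`, `R′` orthogonal),
`|(V_{x′} − V_x)w|² = |(τ_xᵀτ_{x′} − 1)(R′ᵀw)|²`, the holonomy defect of the loop `τ_xᵀτ_{x′}` (root′ → … → root → … → root′) on a vector of the same length
(idea-1 g56's (B3) `pairDiff_eq_loopDefect`, in PART 47's orientation). [folklore] -/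
theorem spread_eq_loopDefect {τ τ' R' : Matrix o o ℝ} (hτ : τᵀ * τ = 1) (w : o → ℝ) :
    ((τ' * R'ᵀ - τ * R'ᵀ) *ᵥ w) ⬝ᵥ ((τ' * R'ᵀ - τ * R'ᵀ) *ᵥ w) = ((τᵀ * τ' - 1) *ᵥ (R'ᵀ *ᵥ w)) ⬝ᵥ ((τᵀ * τ' - 1) *ᵥ (R'ᵀ *ᵥ w)) := by
  have e : (τ' * R'ᵀ - τ * R'ᵀ) *ᵥ w = τ *ᵥ ((τᵀ * τ' - 1) *ᵥ (R'ᵀ *ᵥ w)) := by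
    rw [mulVec_mulVec, mulVec_mulVec, Matrix.mul_sub, Matrix.mul_one, ← Matrix.mul_assoc, mul_transpose_of_orthogonal hτ, Matrix.one_mul,
      Matrix.sub_mul]
  rw [e, self_of_orthogonal hτ]

end Root

/-! ## §4 In PART 47's letters: `hN` with `κ = 2D` from the polar letters and the loop letter; PART 53's END with `κ := 2D` -/

section End

variable {o μ ν β β' : Type*} [Fintype o] [DecidableEq o] [Fintype μ] [Fintype ν] [Fintype β] [DecidableEq β] [Fintype β']
variable {q : μ → ν → ℝ} {W : μ → ν → Matrix o o ℝ} {Q : Matrix (μ × o) (ν × o) ℝ}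
variable {src tgt : β → ν} {R : β → Matrix o o ℝ} {src' tgt' : β' → μ} {R' : β' → Matrix o o ℝ}
variable {Hf : Matrix (ν × o) (ν × o) ℝ} {Hc : Matrix (μ × o) (μ × o) ℝ} {wf wc : ℝ}
variable {σ : β' → ν ≃ ν} {ℓ : ℕ} {xs : β' → ν → ℕ → ν} {γ : β' → ν → ℕ → β} {T : β' → ν → ℕ → Matrix o o ℝ} {m : ℝ}
variable {N : β' → ν → Matrix o o ℝ} {Φ : (ν × o → ℝ) → μ → ℝ} {ϖ ϖ' D : ℝ}

omit [Fintype μ] [Fintype β] [DecidableEq β] [Fintype β'] in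
/-- **`rootDefect_le_of_polar_loops` — PART 47 ∕ 53's `hN` WITH `κ = 2D` FROM LATTICE LOOPS** [our proof]: block weights `q ≥ 0` with `Σ_x q(y,x) = 1`,
orthogonal `W, R, R′`, chains `T`, `N(e′,x) = 1 − W T W′ᵀR′ᵀ`, the POLAR letters `hsym` (mean root-frame defect symmetric) and `hPpsd` (the mean root-frame
TRANSPORT `Σ_x q•W T W′ᵀR′ᵀ` positive semidefinite — the polar factorisation as defined), and the LOOP letter
`hloop : |((W T W′ᵀ)(e′,x)ᵀ·(W T W′ᵀ)(e′,x′) − 1)w|² ≤ D²|w|²` (closed lattice loops through both roots) ⟹ `|N(e′,x)w|² ≤ (2D)²|w|²`. -/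
theorem rootDefect_le_of_polar_loops
    (hq : ∀ y x, 0 ≤ q y x) (hq1 : ∀ y, ∑ x, q y x = 1) (hW : ∀ y x, (W y x)ᵀ * W y x = 1) (hR : ∀ e, (R e)ᵀ * R e = 1)
    (hR' : ∀ e', (R' e')ᵀ * R' e' = 1)
    (hT0 : ∀ e' x, T e' x 0 = 1) (hT : ∀ e' x i, i < ℓ → T e' x (i + 1) = T e' x i * R (γ e' x i))
    (hNdef : ∀ e' x, N e' x = 1 - W (src' e') x * T e' x ℓ * (W (tgt' e') (σ e' x))ᵀ * (R' e')ᵀ)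
    (hsym : ∀ e', (∑ x, q (src' e') x • N e' x)ᵀ = ∑ x, q (src' e') x • N e' x)
    (hPpsd : ∀ e' (w : o → ℝ), 0 ≤ w ⬝ᵥ ((∑ x, q (src' e') x • (W (src' e') x * T e' x ℓ * (W (tgt' e') (σ e' x))ᵀ * (R' e')ᵀ)) *ᵥ w))
    (hloop : ∀ e' x x' (w : o → ℝ),
      (((W (src' e') x * T e' x ℓ * (W (tgt' e') (σ e' x))ᵀ)ᵀ * (W (src' e') x' * T e' x' ℓ * (W (tgt' e') (σ e' x'))ᵀ) - 1) *ᵥ w) ⬝ᵥ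
          (((W (src' e') x * T e' x ℓ * (W (tgt' e') (σ e' x))ᵀ)ᵀ * (W (src' e') x' * T e' x' ℓ * (W (tgt' e') (σ e' x'))ᵀ) - 1) *ᵥ w) ≤
        D ^ 2 * (w ⬝ᵥ w))
    (e' : β') (x : ν) (w : o → ℝ) :
    (N e' x *ᵥ w) ⬝ᵥ (N e' x *ᵥ w) ≤ (2 * D) ^ 2 * (w ⬝ᵥ w) := by
  set y := src' e'
  set y' := tgt' e'
  set τ : ν → Matrix o o ℝ := fun x => W y x * T e' x ℓ * (W y' (σ e' x))ᵀ with hτdef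
  set V : ν → Matrix o o ℝ := fun x => τ x * (R' e')ᵀ with hVdef
  have hTl : ∀ x, (T e' x ℓ)ᵀ * T e' x ℓ = 1 := fun x =>
    orthogonal_partialTransport (R := fun i => R (γ e' x i)) (fun i _ => hR _) (hT0 e' x) (fun i hi => hT e' x i hi) ℓ le_rfl
  have hτo : ∀ x, (τ x)ᵀ * τ x = 1 := fun x => orthogonal_mul (orthogonal_mul (hW _ _) (hTl x)) (transpose_orthogonal (hW _ _))
  have hVo : ∀ x, (V x)ᵀ * V x = 1 := fun x => orthogonal_mul (hτo x) (transpose_orthogonal (hR' e'))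
  have hNV : ∀ x, N e' x = 1 - V x := fun x => by rw [hNdef e' x]
  -- the mean transport `P = Σ q V` and its symmetry from `hsym`
  have hPsym : (∑ x, q y x • V x)ᵀ = ∑ x, q y x • V x := by
    have hs := hsym e'
    simp_rw [hNV, smul_sub, Finset.sum_sub_distrib, ← Finset.sum_smul, hq1, one_smul, transpose_sub, transpose_one] at hs
    exact sub_right_injective hs
  have hPpsd' : ∀ w : o → ℝ, 0 ≤ w ⬝ᵥ ((∑ x, q y x • V x) *ᵥ w) := fun w => hPpsd e' w
  -- the spread from the loop letter
  have hD : ∀ x x' (w : o → ℝ), ((V x' - V x) *ᵥ w) ⬝ᵥ ((V x' - V x) *ᵥ w) ≤ D ^ 2 * (w ⬝ᵥ w) := fun x x' w => by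
    have e := spread_eq_loopDefect (τ := τ x) (τ' := τ x') (R' := R' e') (hτo x) w
    simp only [hVdef]
    rw [e]
    refine (hloop e' x x' _).trans (le_of_eq ?_)
    rw [self_of_orthogonal (transpose_orthogonal (hR' e'))]
  have h := rootDefect_le_two_spread (hq y) (hq1 y) hVo hPsym hPpsd' hD x w
  rwa [← hNV] at h

/-- **`covJensen_polar_massFree_of_loops` — PART 53's `δ = 0` END WITH `κ := 2D` FROM THE LOOP LETTER** [our proof]: the hypotheses of PART 53
`covJensen_polar_massFree` with `hN` REPLACED by the polar letters `hsym`, `hPpsd` and the closed-loop letter `hloop` (`D < 1`).  For all `t, r > 0`: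
`⟨Qu, H_cQu⟩ ≤ (1 + t + (1+t⁻¹)(1+r)ϖ(2D)² + (1+t⁻¹)(1+r⁻¹)·3(2D)²(1 + ϖ + ϖ′)∕(4 − (2D)²))·⟨u, H_f u⟩`. -/
theorem covJensen_polar_massFree_of_loops
    (hq : ∀ y x, 0 ≤ q y x) (hq1 : ∀ y, ∑ x, q y x = 1) (hW : ∀ y x, (W y x)ᵀ * W y x = 1) (hR : ∀ e, (R e)ᵀ * R e = 1)
    (hR' : ∀ e', (R' e')ᵀ * R' e' = 1)
    (hQ : ∀ (u : ν × o → ℝ) (y : μ), (fun a => (Q *ᵥ u) (y, a)) = ∑ x, q y x • (W y x *ᵥ fun b => u (x, b)))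
    (hwc : 0 ≤ wc)
    (hHc : ∀ v : μ × o → ℝ, v ⬝ᵥ (Hc *ᵥ v) ≤
      wc * ∑ e', ((R' e' *ᵥ fun a => v (tgt' e', a)) - fun a => v (src' e', a)) ⬝ᵥ
        ((R' e' *ᵥ fun a => v (tgt' e', a)) - fun a => v (src' e', a)))
    (hHf : ∀ u : ν × o → ℝ, wf * ∑ e, ((R e *ᵥ fun b => u (tgt e, b)) - fun b => u (src e, b)) ⬝ᵥ
        ((R e *ᵥ fun b => u (tgt e, b)) - fun b => u (src e, b)) ≤ u ⬝ᵥ (Hf *ᵥ u))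
    (hσq : ∀ e' x, q (tgt' e') (σ e' x) = q (src' e') x)
    (hx0 : ∀ e' x, xs e' x 0 = x) (hxℓ : ∀ e' x, xs e' x ℓ = σ e' x)
    (hsrc : ∀ e' x i, i < ℓ → src (γ e' x i) = xs e' x i) (htgt : ∀ e' x i, i < ℓ → tgt (γ e' x i) = xs e' x (i + 1))
    (hT0 : ∀ e' x, T e' x 0 = 1) (hT : ∀ e' x i, i < ℓ → T e' x (i + 1) = T e' x i * R (γ e' x i))
    (hmult : ∀ e, ∑ e', ∑ x, ∑ i ∈ range ℓ, (if γ e' x i = e then q (src' e') x else 0) ≤ m)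
    (hw : wc * ℓ * m ≤ wf)
    (hNdef : ∀ e' x, N e' x = 1 - W (src' e') x * T e' x ℓ * (W (tgt' e') (σ e' x))ᵀ * (R' e')ᵀ)
    (hsym : ∀ e', (∑ x, q (src' e') x • N e' x)ᵀ = ∑ x, q (src' e') x • N e' x)
    (hPpsd : ∀ e' (w : o → ℝ), 0 ≤ w ⬝ᵥ ((∑ x, q (src' e') x • (W (src' e') x * T e' x ℓ * (W (tgt' e') (σ e' x))ᵀ * (R' e')ᵀ)) *ᵥ w))
    (hloop : ∀ e' x x' (w : o → ℝ),
      (((W (src' e') x * T e' x ℓ * (W (tgt' e') (σ e' x))ᵀ)ᵀ * (W (src' e') x' * T e' x' ℓ * (W (tgt' e') (σ e' x'))ᵀ) - 1) *ᵥ w) ⬝ᵥ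
          (((W (src' e') x * T e' x ℓ * (W (tgt' e') (σ e' x))ᵀ)ᵀ * (W (src' e') x' * T e' x' ℓ * (W (tgt' e') (σ e' x'))ᵀ) - 1) *ᵥ w) ≤
        D ^ 2 * (w ⬝ᵥ w))
    (hD1 : D < 1) (hD0 : 0 ≤ D)
    (u : ν × o → ℝ)
    (hP : ∀ y, ∑ x, q y x * (((W y x *ᵥ fun b => u (x, b)) - fun a => (Q *ᵥ u) (y, a)) ⬝ᵥ
        ((W y x *ᵥ fun b => u (x, b)) - fun a => (Q *ᵥ u) (y, a))) ≤ Φ u y)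
    (hΦ : wc * ∑ e', Φ u (tgt' e') ≤ ϖ * (u ⬝ᵥ (Hf *ᵥ u))) (hΦ' : wc * ∑ e', Φ u (src' e') ≤ ϖ' * (u ⬝ᵥ (Hf *ᵥ u)))
    {t r : ℝ} (ht : 0 < t) (hr : 0 < r) :
    (Q *ᵥ u) ⬝ᵥ (Hc *ᵥ (Q *ᵥ u)) ≤
      (1 + t + (1 + t⁻¹) * (1 + r) * ϖ * (2 * D) ^ 2 +
          (1 + t⁻¹) * (1 + r⁻¹) * (3 * (2 * D) ^ 2 / (4 - (2 * D) ^ 2)) * (1 + ϖ + ϖ')) * (u ⬝ᵥ (Hf *ᵥ u)) := by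
  have hN : ∀ e' x (w : o → ℝ), (N e' x *ᵥ w) ⬝ᵥ (N e' x *ᵥ w) ≤ (2 * D) ^ 2 * (w ⬝ᵥ w) :=
    rootDefect_le_of_polar_loops hq hq1 hW hR hR' hT0 hT hNdef hsym hPpsd hloop
  have hκ : (2 * D) ^ 2 < 4 := by nlinarith
  exact covJensen_polar_massFree hq hq1 hW hR hR' hQ hwc hHc hHf hσq hx0 hxℓ hsrc htgt hT0 hT hmult hw hNdef hN hsym hκ u hP hΦ hΦ' ht hr

end End

end Summit.QuantumFields.BalabanUV.Beta.GAN24.DerivativeRateTransferJensenMassFreeSpread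

end
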